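import Literature.MathematicalPhysics.QuantumFieldTheory.Balaban1983to89.Node00.BgLettersOfRecord
import Literature.MathematicalPhysics.QuantumFieldTheory.Balaban1983to89.Node00.LinearisedAveragingAtBackground
import HarnessLib

/-!
# The record's averaging letters `Q = Q(U₀)` and `Q′ = Q′(U₀)` of [Balaban1985BackgroundPropagators] (3.13)–(3.19), pinned (M1 file 3b)

statement-level skeleton of published definitions with citation tags; nothing here is a claim about the Yang–Mills mass gap
(cell `pub-ymgap`, unit `pub-ymgap-node00-def-Y` g36; Node00 = the record `(F : T4Family, SU(N), avOfRecord)`).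

WHAT IS HERE.  File 3a (`Node00.BgLettersOfRecord`) constructed `𝔊(U₀)` / `H₁(U₀)` of [Balaban1985Variational] (110)–(117) at the record with the two
averaging operators `Q` (bond fields, (3.13)–(3.16)) and `Q′` (scalar∕site fields, (3.18)–(3.19)) left as DATA slots.  This file FILLS the two slots
BY CONSTRUCTION from the record's own averaging operation `avOfRecord = blockAvg expMeanLogSU` ([Balaban1987RG1] (0.4)):

* §1 `cplxOp` — the canonical complexification of a real-linear operator `T` on matrix-valued lattice fields from its values on the real form
  `𝔲(N)`-valued fields: `T^ℂ Y := T(𝔞Y) + i·T(𝔞(−iY))`, `𝔞Y = (Y − Y*)/2` ([Balaban1985BackgroundPropagators] p.393: «we extend it to an analytic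
  function … with values in Gᶜ … Q(U) … on the complex linear space of functions with values in 𝔤ᶜ»); `cplxOp T` is `ℂ`-linear and agrees with `T`
  on skew-Hermitian fields (`cplxOp_apply_of_skew`), and on Hermitian fields `A` it is print's `(1/i)·T(iA)` (`cplxOp_apply_of_herm`).
* §2 `qSkewOp k U₀` / `qCplxOp k U₀` — PRINT'S `Q_k(U₀) = Q(Ū^{k-1}(U₀)) ⋯ Q(U₀)` of (3.13)–(3.15) ∕ [Balaban1985Variational] (44): the Fréchet derivative
  `Node00.dIterL k ↑U₀` (n07-w1's `LinearisedAveragingAtBackground`, = `fderiv ℝ (iterM k) ↑U₀`, the derivative of the matrix extension of the TRUE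
  `k`-fold averaging of record) taken in the LEFT chart `U = exp(iηA)·U₀` of [Balaban1985Variational] (18)–(22) (direction `b ↦ X(b)·U₀(b)`, as in
  `Node00.BackgroundMapOfRecord.chartCfg`), RIGHT-trivialised at the coarse background `Ū^k(U₀)` (`· (Ū^k(U₀)(c))*`) and `L^{-k}`-normalised
  ((44): `Ū^k(exp(iηA)U₀) = exp[i L^kη Q_k(U₀)A + O(A²)]·Ū^k(U₀)`, the `η` cancels), then complexified by §1.
* §3 `siteAvgStep U` / `siteAvgIter av U₀ k` — PRINT'S SITE AVERAGING (3.18)–(3.19) (the contours `Γ_{y,x}` and transporters `U(Γ_{y,x})` of [Balaban1985Averaging] (42)–(43), there cited in the preprint numbering «(52), (53) in [5]»):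
  `(Q′(U)λ)(y) = Σ_{x ∈ B(y)} L^{-d} R(U(Γ_{y,x})) λ(x)`, `R(g)X = gXg*`, with the record's CENTRED blocks (`Setup.emb`, `BlockAveraging.off`) and the
  straight-run contours `Γ_{y,x} = stairWord 1 (off r)` from the centre `emb y`; iterated along the successive averages `Ū^j(U₀) = Averaging.iter av j U₀`.
* §4 the record instances in the SLOT TYPES of `Node00.frakGOfRecord`: the (3.16) weight `wBRec F K k ≡ (L^kη)^{d-2}` (`= 1` at the record, `η = L^{-k}`),
  `QOfRecord F N k U₀ : BondL2K ℂ … (c0Rec F K k) (WRec N) →ₗ[ℂ] WL2 ℂ (wBRec F K k) (WRec N)` and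
  `QprimeOfRecord F N k U₀ : SiteL2K ℂ … (c0Rec F K k) (WRec N) →ₗ[ℂ] (Site (F.P K) k → M_N(ℂ))`, read through `phiRec`, `bondToLit`/`siteToLit`, `WL2.linearEquiv`.
* §5 THE PIN: `frakGOfRecordAtBg F N K k Ω U₀ a hpos hQ := frakGOfRecord … (QOfRecord …) (QprimeOfRecord …) a hpos hQ` and `H1OfRecordAtBg` — the
  `𝒢`-slot of `BgSchemeOnLit` with NO operator data left: only the number `a` and the two DISPLAYED proofs `hpos` ([B9] Thm 3.11 at the record) and
  `hQ` (`Q(U₀)` onto) remain as hypotheses (text (B) of the cell's M1 plan; E-guard: never `∃ Q`, never `∃ letters`).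

HONEST LABELS.  (1) DEFINITIONAL: no estimate, no positivity, no surjectivity is asserted here.  (2) `dIterL` is TOTAL (`fderiv` junk off the
differentiability locus); under n07-w1's guard `SmallBelow … k U₀` it IS the derivative (`hasFDerivAt_iterM`), so `qCplxOp`/`QOfRecord` are print's
`Q_k(U₀)` exactly there and a harmless total extension elsewhere.  (3) CHART: left chart∕right trivialisation as in (18)–(22), (44); n07-w1's `qLin` uses the
right chart `U₀·exp(X)` — the two differ by the unitary conjugations `Ad(U₀(b))`, `Ad(Ū^k(U₀)(c))`, immaterial for (117)-type norms; no identification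
lemma is filed here.  (4) `hQ : Function.Surjective (QOfRecord F N k U₀)` is NOT a theorem of the tree for this print-faithful letter (it is the submersion
property of `U ↦ Ū^k(U)` at a guarded background; print inverts `QG₁Q*`, [Balaban1985Variational] (103)/(111)); the tree's onto-theorems
`Node00.OpsYQOnto.QY_surjective` (θ-world straight-contour letter) and `B9Eq315QTower.QkOfU_surjective` (explicit corner-anchored (124)/(127) letter) are
about DIFFERENT operators and are cited as analogues only.  (5) MULTI-LEVEL `Q(U₀) = ⊕_j Q_j(U₀)|_{Λ_j}` of (3.15)/[Balaban1985Variational] (100) is NOT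
HERE: at the record's P0 (`Ω ≡ univ`, all-torus) only the top level `j = k` is present, which is what `QOfRecord` is.  (6) No `instance`, no notation,
no `sorry`; `wBRec_fact` is a plain theorem producing the `Fact` the slot type wants.
-/

noncomputable section

open scoped Matrix Matrix.Norms.L2Operator InnerProductSpace ComplexConjugate

namespace Literature.MathematicalPhysics.QuantumFieldTheory.Balaban1983to89.Node00

open T4Continuum BlockAveraging
open B4Sect5Torus (TSite)
open B9SectCLatticeCarrier (Bond)
open B9Eq311L2Pairing (WL2)
open B11Eq103H1Complex (SiteL2K BondL2K)
open B11Eq115Space (NegSize)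

/-! ## §1. Complexification of a real-linear operator from the real form `𝔲(N)` ([Balaban1985BackgroundPropagators] p.393) -/

section Complexify

variable {ι κ n : Type*}

/-- The skew-Hermitian part `𝔞Y = (Y − Y*)/2` of a matrix-valued lattice field, bondwise (the projection of `𝔤ᶜ = M_N(ℂ)`-valued fields onto the real
form of `𝔲(N)`-valued ones along `i𝔲(N)`). [cite: Balaban1985BackgroundPropagators, (3.1) p.390, p.393] -/
def skewField (Y : ι → Matrix n n ℂ) : ι → Matrix n n ℂ := fun b => (2⁻¹ : ℂ) • (Y b - (Y b)ᴴ)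

/-- Unfolding of `skewField`. [cite: Balaban1985BackgroundPropagators, p.393 (bookkeeping)] -/
@[simp] theorem skewField_apply (Y : ι → Matrix n n ℂ) (b : ι) : skewField Y b = (2⁻¹ : ℂ) • (Y b - (Y b)ᴴ) := rfl

/-- `𝔞` is additive. [cite: Balaban1985BackgroundPropagators, p.393 (bookkeeping)] -/
theorem skewField_add (Y Y' : ι → Matrix n n ℂ) : skewField (Y + Y') = skewField Y + skewField Y' := by
  funext b
  simp only [skewField_apply, Pi.add_apply, Matrix.conjTranspose_add, ← smul_add]
  congr 1
  abel

/-- `𝔞(−Y) = −𝔞Y`. [cite: Balaban1985BackgroundPropagators, p.393 (bookkeeping)] -/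
theorem skewField_neg (Y : ι → Matrix n n ℂ) : skewField (-Y) = -skewField Y := by
  funext b
  simp only [skewField_apply, Pi.neg_apply, Matrix.conjTranspose_neg, ← smul_neg]
  congr 1
  abel

/-- `𝔞` commutes with REAL scalars (written as complex numbers). [cite: Balaban1985BackgroundPropagators, p.393 (bookkeeping)] -/
theorem skewField_ofReal_smul (x : ℝ) (Y : ι → Matrix n n ℂ) : skewField ((x : ℂ) • Y) = (x : ℂ) • skewField Y := by
  ext b i j
  simp only [skewField_apply, Pi.smul_apply, Matrix.smul_apply, Matrix.sub_apply, Matrix.conjTranspose_apply, smul_eq_mul,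
    Complex.star_def, map_mul, Complex.conj_ofReal]
  ring

/-- A skew-Hermitian field is its own skew part. [cite: Balaban1985BackgroundPropagators, p.393 (bookkeeping)] -/
theorem skewField_of_skew {Y : ι → Matrix n n ℂ} (hY : ∀ b, (Y b)ᴴ = -Y b) : skewField Y = Y := by
  funext b
  rw [skewField_apply, hY b, sub_neg_eq_add, ← two_smul ℂ (Y b), smul_smul, inv_mul_cancel₀ two_ne_zero, one_smul]

/-- For a skew-Hermitian field `Y`, `−iY` is Hermitian, so `𝔞(−iY) = 0`. [cite: Balaban1985BackgroundPropagators, p.393 (bookkeeping)] -/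
theorem skewField_negI_smul_of_skew {Y : ι → Matrix n n ℂ} (hY : ∀ b, (Y b)ᴴ = -Y b) : skewField (-Complex.I • Y) = 0 := by
  funext b
  simp [Matrix.conjTranspose_smul, hY b]

/-- A Hermitian field has zero skew part. [cite: Balaban1985BackgroundPropagators, p.393 (bookkeeping)] -/
theorem skewField_of_herm {A : ι → Matrix n n ℂ} (hA : ∀ b, (A b)ᴴ = A b) : skewField A = 0 := by
  funext b
  simp [hA b]

/-- For a Hermitian field `A`, `−iA` is skew-Hermitian: `𝔞(−iA) = −iA`. [cite: Balaban1985BackgroundPropagators, p.393 (bookkeeping)] -/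
theorem skewField_negI_smul_of_herm {A : ι → Matrix n n ℂ} (hA : ∀ b, (A b)ᴴ = A b) : skewField (-Complex.I • A) = -Complex.I • A := by
  funext b
  simp only [skewField_apply, Pi.smul_apply, Matrix.conjTranspose_smul, hA b, Complex.star_def, map_neg, Complex.conj_I, neg_neg]
  rw [show Complex.I • A b = -(-Complex.I • A b) by rw [neg_smul, neg_neg], sub_neg_eq_add, ← two_smul ℂ, smul_smul,
    inv_mul_cancel₀ two_ne_zero, one_smul]

/-- ★ THE REAL-FORM DECOMPOSITION `Y = 𝔞Y + i·𝔞(−iY)` (`M_N(ℂ) = 𝔲(N) ⊕ i·𝔲(N)`, bondwise). [cite: Balaban1985BackgroundPropagators, p.393] -/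
theorem skewField_decomp (Y : ι → Matrix n n ℂ) : skewField Y + Complex.I • skewField (-Complex.I • Y) = Y := by
  ext b i j
  simp only [Pi.add_apply, Pi.smul_apply, skewField_apply, Matrix.add_apply, Matrix.smul_apply, Matrix.sub_apply,
    Matrix.conjTranspose_apply, smul_eq_mul, Complex.star_def, map_mul, map_neg, Complex.conj_I, neg_neg]
  linear_combination (-(2⁻¹ : ℂ) * (Y b i j + (starRingEnd ℂ) (Y b j i))) * Complex.I_sq

/-- Real scalars act on matrix fields through `ℝ ⊂ ℂ`. [cite: Balaban1985BackgroundPropagators, p.393 (bookkeeping)] -/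
private theorem ofReal_smul_field (x : ℝ) (Z : ι → Matrix n n ℂ) : ((x : ℂ) • Z) = x • Z := by
  ext b i j
  simp [Matrix.smul_apply, Complex.real_smul]

variable (T : (ι → Matrix n n ℂ) →ₗ[ℝ] (κ → Matrix n n ℂ))

/-- A real-linear `T` commutes with real scalars written in `ℂ`. [cite: Balaban1985BackgroundPropagators, p.393 (bookkeeping)] -/
private theorem map_ofReal_smul (x : ℝ) (Z : ι → Matrix n n ℂ) : T ((x : ℂ) • Z) = (x : ℂ) • T Z := by
  rw [ofReal_smul_field, map_smul, ofReal_smul_field]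

/-- **THE COMPLEXIFICATION `T^ℂ Y = T(𝔞Y) + i·T(𝔞(−iY))`** of a real-linear operator on matrix fields, as a function.
[cite: Balaban1985BackgroundPropagators, p.393] -/
def cplxFun (Y : ι → Matrix n n ℂ) : κ → Matrix n n ℂ := T (skewField Y) + Complex.I • T (skewField (-Complex.I • Y))

/-- `T^ℂ` is additive. [cite: Balaban1985BackgroundPropagators, p.393 (bookkeeping)] -/
theorem cplxFun_add (Y Y' : ι → Matrix n n ℂ) : cplxFun T (Y + Y') = cplxFun T Y + cplxFun T Y' := by
  simp only [cplxFun, smul_add, skewField_add, map_add]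
  abel

/-- `T^ℂ` commutes with real scalars. [cite: Balaban1985BackgroundPropagators, p.393 (bookkeeping)] -/
theorem cplxFun_ofReal_smul (x : ℝ) (Y : ι → Matrix n n ℂ) : cplxFun T ((x : ℂ) • Y) = (x : ℂ) • cplxFun T Y := by
  simp only [cplxFun]
  rw [smul_comm (-Complex.I) (x : ℂ) Y, skewField_ofReal_smul, skewField_ofReal_smul, map_ofReal_smul, map_ofReal_smul,
    smul_comm Complex.I (x : ℂ), smul_add]

/-- `T^ℂ (iY) = i · T^ℂ Y`. [cite: Balaban1985BackgroundPropagators, p.393 (bookkeeping)] -/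
theorem cplxFun_I_smul (Y : ι → Matrix n n ℂ) : cplxFun T (Complex.I • Y) = Complex.I • cplxFun T Y := by
  simp only [cplxFun]
  have h1 : -Complex.I • Complex.I • Y = Y := by
    rw [smul_smul, neg_mul, Complex.I_mul_I, neg_neg, one_smul]
  have h2 : skewField (-Complex.I • Y) = -skewField (Complex.I • Y) := by
    rw [neg_smul, skewField_neg]
  rw [h1, h2, map_neg, smul_add, smul_neg, smul_neg, smul_smul, Complex.I_mul_I, neg_smul, one_smul, neg_neg, add_comm]

/-- `T^ℂ` is `ℂ`-homogeneous. [cite: Balaban1985BackgroundPropagators, p.393 (bookkeeping)] -/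
theorem cplxFun_smul (c : ℂ) (Y : ι → Matrix n n ℂ) : cplxFun T (c • Y) = c • cplxFun T Y := by
  have hc : c • Y = (c.re : ℂ) • Y + (c.im : ℂ) • (Complex.I • Y) := by
    conv_lhs => rw [← Complex.re_add_im c]
    rw [add_smul, mul_smul]
  rw [hc, cplxFun_add, cplxFun_ofReal_smul, cplxFun_ofReal_smul, cplxFun_I_smul]
  conv_rhs => rw [← Complex.re_add_im c]
  rw [add_smul, mul_smul]

/-- ★ **THE COMPLEXIFIED OPERATOR `T^ℂ : (ι → M_N(ℂ)) →ₗ[ℂ] (κ → M_N(ℂ))`** («extend … to Gᶜ, 𝔤ᶜ», p.393).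
[cite: Balaban1985BackgroundPropagators, p.393] -/
def cplxOp : (ι → Matrix n n ℂ) →ₗ[ℂ] (κ → Matrix n n ℂ) where
  toFun := cplxFun T
  map_add' := cplxFun_add T
  map_smul' := cplxFun_smul T

/-- Unfolding of `cplxOp`. [cite: Balaban1985BackgroundPropagators, p.393 (bookkeeping)] -/
@[simp] theorem cplxOp_apply (Y : ι → Matrix n n ℂ) : cplxOp T Y = T (skewField Y) + Complex.I • T (skewField (-Complex.I • Y)) := rfl

/-- ★ `T^ℂ` AGREES WITH `T` ON THE REAL FORM: for skew-Hermitian fields `T^ℂ Y = T Y`. [cite: Balaban1985BackgroundPropagators, p.393] -/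
theorem cplxOp_apply_of_skew {Y : ι → Matrix n n ℂ} (hY : ∀ b, (Y b)ᴴ = -Y b) : cplxOp T Y = T Y := by
  rw [cplxOp_apply, skewField_of_skew hY, skewField_negI_smul_of_skew hY, map_zero, smul_zero, add_zero]

/-- ★ ON HERMITIAN FIELDS `A` (print's variables, `U = exp(iηA)U₀`): `T^ℂ A = i·T(−iA) = (1/i)·T(iA)` — print's `Q(U₀)A`.
[cite: Balaban1985BackgroundPropagators, (3.13) p.393; Balaban1985Variational, (44) p.285] -/
theorem cplxOp_apply_of_herm {A : ι → Matrix n n ℂ} (hA : ∀ b, (A b)ᴴ = A b) : cplxOp T A = Complex.I • T (-Complex.I • A) := by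
  rw [cplxOp_apply, skewField_of_herm hA, map_zero, zero_add, skewField_negI_smul_of_herm hA]

/-- ★ COMPLEXIFYING A COMPLEX-LINEAR OPERATOR GIVES IT BACK: `(S↾ℝ)^ℂ = S` (the construction is the canonical one). [cite: Balaban1985BackgroundPropagators, p.393] -/
theorem cplxOp_restrictScalars (S : (ι → Matrix n n ℂ) →ₗ[ℂ] (κ → Matrix n n ℂ)) : cplxOp (S.restrictScalars ℝ) = S :=
  LinearMap.ext fun Y => by
    rw [cplxOp_apply, LinearMap.restrictScalars_apply, LinearMap.restrictScalars_apply, ← map_smul, ← map_add, skewField_decomp]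

end Complexify

/-! ## §2. Print's `Q_k(U₀)`: the linearised `k`-fold averaging of record, left chart, right-trivialised, `L^{-k}`-normalised, complexified -/

section BondAveraging

variable {P : Params} {N : ℕ}

/-- The LEFT-CHART velocity field: the direction `b ↦ X(b)·U₀(b)` of the curve `t ↦ exp(tX)·U₀` at `U₀` ([Balaban1985Variational] (18): `U = U′U₀`).
[cite: Balaban1985Variational, (18)–(22) p.281] -/
def leftVel (U₀ : GaugeField P 0 (SU N)) : (PBond P 0 → Matrix (Fin N) (Fin N) ℂ) →ₗ[ℝ] (PBond P 0 → Matrix (Fin N) (Fin N) ℂ) where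
  toFun X := fun b => X b * (U₀ b : Matrix (Fin N) (Fin N) ℂ)
  map_add' X X' := by
    funext b
    simp only [Pi.add_apply, add_mul]
  map_smul' x X := by
    funext b
    simp only [Pi.smul_apply, RingHom.id_apply, smul_mul_assoc]

/-- Unfolding of `leftVel`. [cite: Balaban1985Variational, (18) p.281 (bookkeeping)] -/
@[simp] theorem leftVel_apply (U₀ : GaugeField P 0 (SU N)) (X : PBond P 0 → Matrix (Fin N) (Fin N) ℂ) (b : PBond P 0) :
    leftVel U₀ X b = X b * (U₀ b : Matrix (Fin N) (Fin N) ℂ) := rfl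

/-- RIGHT TRIVIALISATION at the coarse field `V` with the `L^{-k}` normalisation of (44): `W ↦ (c ↦ L^{-k} · W(c)·V(c)*)`.
[cite: Balaban1985Variational, (44) p.285] -/
def rightTrivNorm (k : ℕ) (V : PBond P k → Matrix (Fin N) (Fin N) ℂ) :
    (PBond P k → Matrix (Fin N) (Fin N) ℂ) →ₗ[ℝ] (PBond P k → Matrix (Fin N) (Fin N) ℂ) where
  toFun W := fun c => ((P.L : ℂ) ^ k)⁻¹ • (W c * star (V c))
  map_add' W W' := by
    funext c
    simp only [Pi.add_apply, add_mul, smul_add]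
  map_smul' x W := by
    funext c
    simp only [Pi.smul_apply, RingHom.id_apply, smul_mul_assoc]
    rw [smul_comm]

/-- Unfolding of `rightTrivNorm`. [cite: Balaban1985Variational, (44) p.285 (bookkeeping)] -/
@[simp] theorem rightTrivNorm_apply (k : ℕ) (V W : PBond P k → Matrix (Fin N) (Fin N) ℂ) (c : PBond P k) :
    rightTrivNorm k V W c = ((P.L : ℂ) ^ k)⁻¹ • (W c * star (V c)) := rfl

/-- ★★ **`Q_k(U₀)` ON THE REAL FORM** — the real-linear operator `X ↦ (c ↦ L^{-k} · (D(Ū^k)(↑U₀)[X·U₀])(c) · (Ū^k(↑U₀)(c))*)` built from n07-w1's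
`dIterL k ↑U₀ = fderiv ℝ (iterM k) ↑U₀` (the derivative of the matrix extension of the record's `k`-fold averaging `avOfRecord`).
[cite: Balaban1985BackgroundPropagators, (3.13)–(3.15) p.393; Balaban1985Variational, (44) p.285] -/
def qSkewOp (k : ℕ) (U₀ : GaugeField P 0 (SU N)) : (PBond P 0 → Matrix (Fin N) (Fin N) ℂ) →ₗ[ℝ] (PBond P k → Matrix (Fin N) (Fin N) ℂ) :=
  rightTrivNorm k (iterM k (coeField U₀)) ∘ₗ
    (dIterL k (coeField U₀) : (PBond P 0 → Matrix (Fin N) (Fin N) ℂ) →ₗ[ℝ] (PBond P k → Matrix (Fin N) (Fin N) ℂ)) ∘ₗ leftVel U₀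

/-- Unfolding of `qSkewOp`. [cite: Balaban1985BackgroundPropagators, (3.13) p.393 (bookkeeping)] -/
theorem qSkewOp_apply (k : ℕ) (U₀ : GaugeField P 0 (SU N)) (X : PBond P 0 → Matrix (Fin N) (Fin N) ℂ) (c : PBond P k) :
    qSkewOp k U₀ X c =
      ((P.L : ℂ) ^ k)⁻¹ • (dIterL k (coeField U₀) (fun b => X b * (U₀ b : Matrix (Fin N) (Fin N) ℂ)) c * star (iterM k (coeField U₀) c)) := rfl

/-- `Q_0(U₀) = id` on the real form (the chart conventions cancel: `X·U₀·U₀* = X`). [cite: Balaban1985BackgroundPropagators, (3.19) p.393 («Q′_0 = id»); Balaban1987RG1, (0.21) p.256] -/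
theorem qSkewOp_zero_apply (U₀ : GaugeField P 0 (SU N)) (X : PBond P 0 → Matrix (Fin N) (Fin N) ℂ) : qSkewOp 0 U₀ X = X := by
  funext c
  have hu : (U₀ c : Matrix (Fin N) (Fin N) ℂ) * star (U₀ c : Matrix (Fin N) (Fin N) ℂ) = 1 :=
    Matrix.mem_unitaryGroup_iff.mp (Matrix.mem_specialUnitaryGroup_iff.mp (U₀ c).2).1
  rw [qSkewOp_apply, dIterL_zero, pow_zero, inv_one, one_smul, ContinuousLinearMap.id_apply, iterM_zero, coeField_apply, mul_assoc, hu, mul_one]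

/-- ★★★ **PRINT'S `Q_k(U₀)` ON `𝔤ᶜ`-VALUED BOND FIELDS** — the complexification (§1) of `qSkewOp k U₀`: a `ℂ`-linear operator from level-`0` to
level-`k` matrix-valued bond fields; on Hermitian `A` it is `(1/i)·qSkewOp(iA)` (`cplxOp_apply_of_herm`), i.e. (3.13)/(44) verbatim.
[cite: Balaban1985BackgroundPropagators, (3.13)–(3.15) p.393; Balaban1985Variational, (44) p.285, (51) p.286] -/
def qCplxOp (k : ℕ) (U₀ : GaugeField P 0 (SU N)) : (PBond P 0 → Matrix (Fin N) (Fin N) ℂ) →ₗ[ℂ] (PBond P k → Matrix (Fin N) (Fin N) ℂ) :=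
  cplxOp (qSkewOp k U₀)

/-- `Q_0(U₀) = id`. [cite: Balaban1985BackgroundPropagators, (3.19) p.393; Balaban1987RG1, (0.21) p.256] -/
theorem qCplxOp_zero (U₀ : GaugeField P 0 (SU N)) : qCplxOp 0 U₀ = LinearMap.id := by
  have h : qSkewOp 0 U₀ = (LinearMap.id : (PBond P 0 → Matrix (Fin N) (Fin N) ℂ) →ₗ[ℂ] (PBond P 0 → Matrix (Fin N) (Fin N) ℂ)).restrictScalars ℝ :=
    LinearMap.ext fun X => qSkewOp_zero_apply U₀ X
  rw [qCplxOp, h, cplxOp_restrictScalars]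

/-- `Q_k(U₀)` agrees with the real-linear derivative on skew-Hermitian (Lie-algebra valued) directions. [cite: Balaban1985BackgroundPropagators, (3.13) p.393] -/
theorem qCplxOp_apply_of_skew (k : ℕ) (U₀ : GaugeField P 0 (SU N)) {Y : PBond P 0 → Matrix (Fin N) (Fin N) ℂ} (hY : ∀ b, (Y b)ᴴ = -Y b) :
    qCplxOp k U₀ Y = qSkewOp k U₀ Y :=
  cplxOp_apply_of_skew _ hY

/-- `Q_k(U₀)A = i · qSkewOp(−iA)` on Hermitian `A` (print's variables). [cite: Balaban1985BackgroundPropagators, (3.13) p.393; Balaban1985Variational, (44) p.285] -/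
theorem qCplxOp_apply_of_herm (k : ℕ) (U₀ : GaugeField P 0 (SU N)) {A : PBond P 0 → Matrix (Fin N) (Fin N) ℂ} (hA : ∀ b, (A b)ᴴ = A b) :
    qCplxOp k U₀ A = Complex.I • qSkewOp k U₀ (-Complex.I • A) :=
  cplxOp_apply_of_herm _ hA

end BondAveraging

/-! ## §3. Print's site averaging `Q′` of (3.18)–(3.19) (contours of [Balaban1985Averaging] (42)–(43)), with the record's centred blocks -/

section SiteAveraging

variable {P : Params} {j : ℕ} {N : ℕ}

/-- The adjoint action `R(g)X = g X g*` of `SU(N)` on `𝔤ᶜ = M_N(ℂ)`, as a `ℂ`-linear map. [cite: Balaban1985BackgroundPropagators, (3.1) p.390] -/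
def adM (g : SU N) : Matrix (Fin N) (Fin N) ℂ →ₗ[ℂ] Matrix (Fin N) (Fin N) ℂ :=
  LinearMap.mulLeft ℂ (g : Matrix (Fin N) (Fin N) ℂ) ∘ₗ LinearMap.mulRight ℂ (star (g : Matrix (Fin N) (Fin N) ℂ))

/-- Unfolding of `adM`. [cite: Balaban1985BackgroundPropagators, (3.1) p.390 (bookkeeping)] -/
@[simp] theorem adM_apply (g : SU N) (X : Matrix (Fin N) (Fin N) ℂ) :
    adM g X = (g : Matrix (Fin N) (Fin N) ℂ) * X * star (g : Matrix (Fin N) (Fin N) ℂ) := by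
  simp [adM, mul_assoc]

variable [NeZero N]

variable (P) in
/-- The CENTRE CONTOUR word `Γ_{y,x}` to the block site of index `r` (straight runs in the coordinate order, net displacement `off r`).
[cite: Balaban1985Averaging, (42)–(43) pp.23–24; Balaban1987RG1, (0.3) p.252] -/
def ctrWord (r : Fin P.d → Fin P.L) : List (Letter P.d) := stairWord (Equiv.refl _) (off r)

/-- The centre contour of index `r` ENDS AT THE BLOCK SITE `x_r = Site.blockSite y r ∈ B(y)` (the tree's corner-offset parametrisation of `B(y)`,
`TorusGeometry`: `Site.blockOf_blockSite`, `Site.blockEquiv`): `emb y + off r = nL + r`. [cite: Balaban1987RG1, (0.1), (0.3) p.252] -/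
theorem walkEnd_emb_ctrWord (y : Site P (j + 1)) (r : Fin P.d → Fin P.L) : walkEnd (emb y) (ctrWord P r) = Site.blockSite y r := by
  funext ν
  rw [walkEnd_apply, ctrWord, netDisp_stairWord]
  show (((y ν).val * P.L + (P.L - 1) / 2 : ℕ) : ZMod (P.sitesPerDir j)) + ((off r ν : ℤ) : ZMod (P.sitesPerDir j)) =
    (((y ν).val * P.L + r ν : ℕ) : ZMod (P.sitesPerDir j))
  simp only [off]
  set h : ℕ := (P.L - 1) / 2
  rw [← Int.cast_natCast (R := ZMod (P.sitesPerDir j)) ((y ν).val * P.L + h), ← Int.cast_add,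
    ← Int.cast_natCast (R := ZMod (P.sitesPerDir j)) ((y ν).val * P.L + r ν)]
  congr 1
  push_cast
  ring

/-- In the standing range the contour end lies in `B(y)`. [cite: Balaban1987RG1, (0.1), (0.3) p.252 (bookkeeping)] -/
theorem blockOf_walkEnd_emb_ctrWord (hj : j + 1 ≤ P.m + P.K) (y : Site P (j + 1)) (r : Fin P.d → Fin P.L) :
    blockOf (walkEnd (emb y) (ctrWord P r)) = y := by
  rw [walkEnd_emb_ctrWord, Site.blockOf_blockSite hj]

/-- The transporter `U(Γ_{y,x_r})` along the centre contour. [cite: Balaban1985BackgroundPropagators, (3.19) p.393; Balaban1985Averaging, (42) p.23] -/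
def ctrHol (U : GaugeField P j (SU N)) (y : Site P (j + 1)) (r : Fin P.d → Fin P.L) : SU N := holAt U (walk (emb y) (ctrWord P r))

/-- ★ **THE ONE-STEP SITE AVERAGING `Q′(U)` OF (3.18)**: `(Q′(U)λ)(y) = Σ_{x∈B(y)} L^{-d} R(U(Γ_{y,x})) λ(x)`, `ℂ`-linear on `𝔤ᶜ`-valued site fields.
[cite: Balaban1985BackgroundPropagators, (3.18)–(3.19) p.393; Balaban1985Averaging, (42) p.23] -/
def siteAvgStep (U : GaugeField P j (SU N)) : (Site P j → Matrix (Fin N) (Fin N) ℂ) →ₗ[ℂ] (Site P (j + 1) → Matrix (Fin N) (Fin N) ℂ) :=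
  LinearMap.pi fun y => ∑ r : Fin P.d → Fin P.L, ((P.L : ℂ) ^ P.d)⁻¹ • (adM (ctrHol U y r) ∘ₗ LinearMap.proj (Site.blockSite y r))

/-- Unfolding of `siteAvgStep`. [cite: Balaban1985BackgroundPropagators, (3.18) p.393 (bookkeeping)] -/
theorem siteAvgStep_apply (U : GaugeField P j (SU N)) (lam : Site P j → Matrix (Fin N) (Fin N) ℂ) (y : Site P (j + 1)) :
    siteAvgStep U lam y =
      ∑ r : Fin P.d → Fin P.L, ((P.L : ℂ) ^ P.d)⁻¹ •
        ((ctrHol U y r : Matrix (Fin N) (Fin N) ℂ) * lam (Site.blockSite y r) * star (ctrHol U y r : Matrix (Fin N) (Fin N) ℂ)) := by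
  simp [siteAvgStep, LinearMap.pi_apply, LinearMap.sum_apply, LinearMap.smul_apply, LinearMap.comp_apply]

/-- ★ **THE `k`-STEP SITE AVERAGING `Q′_k(U₀)` OF (3.19)**: `Q′_{j+1}(U₀) = Q′(Ū^j(U₀)) ∘ Q′_j(U₀)`, `Q′_0 = id`, along the successive averages
`Ū^j(U₀) = Averaging.iter av j U₀` of a family of averaging operations. [cite: Balaban1985BackgroundPropagators, (3.19) p.393; Balaban1985Averaging, (43) p.24] -/
def siteAvgIter (av : ∀ j, Averaging P j (SU N)) (U₀ : GaugeField P 0 (SU N)) :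
    (k : ℕ) → ((Site P 0 → Matrix (Fin N) (Fin N) ℂ) →ₗ[ℂ] (Site P k → Matrix (Fin N) (Fin N) ℂ))
  | 0 => LinearMap.id
  | k + 1 => siteAvgStep (Averaging.iter av k U₀) ∘ₗ siteAvgIter av U₀ k

/-- `Q′_0 = id`. [cite: Balaban1985BackgroundPropagators, (3.19) p.393 (bookkeeping)] -/
@[simp] theorem siteAvgIter_zero (av : ∀ j, Averaging P j (SU N)) (U₀ : GaugeField P 0 (SU N)) :
    siteAvgIter av U₀ 0 = LinearMap.id := rfl

/-- `Q′_{k+1}(U₀) = Q′(Ū^k(U₀)) ∘ Q′_k(U₀)`. [cite: Balaban1985BackgroundPropagators, (3.19) p.393 (bookkeeping)] -/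
theorem siteAvgIter_succ (av : ∀ j, Averaging P j (SU N)) (U₀ : GaugeField P 0 (SU N)) (k : ℕ) :
    siteAvgIter av U₀ (k + 1) = siteAvgStep (Averaging.iter av k U₀) ∘ₗ siteAvgIter av U₀ k := rfl

end SiteAveraging

/-! ## §4. The record instances in the slot types of `Node00.frakGOfRecord` -/

section Record

variable (F : T4Family) (N : ℕ) {K : ℕ} (k : ℕ)

variable (K) in
/-- **THE (3.16) WEIGHT `(L^kη)^{d−2}` ON LEVEL-`k` BONDS** (all-torus case `j = k` of `⟨A, Q*aQA⟩ = Σ_j a Σ_{b∈Λ_j} (L^jη)^{d−2} |(Q_jA)(b)|²`).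
[cite: Balaban1985BackgroundPropagators, (3.16) p.393] -/
def wBRec : PBond (F.P K) k → ℝ := fun _ => (((F.P K).L : ℝ) ^ k * (F.P K).eta k) ^ ((F.P K).d - 2)

/-- At the record `η = η_k = L^{-k}`, so the (3.16) weight is `1`. [cite: Balaban1985BackgroundPropagators, (3.16) p.393; Balaban1987RG1, (1.1) p.260] -/
theorem wBRec_eq_one (c : PBond (F.P K) k) : wBRec F K k c = 1 := by
  have hL : ((F.P K).L : ℝ) ≠ 0 := Nat.cast_ne_zero.mpr (F.P K).L_pos.ne'
  simp only [wBRec, Params.eta, ← mul_pow, mul_inv_cancel₀ hL, one_pow]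

/-- The (3.16) weight is positive. [cite: Balaban1985BackgroundPropagators, (3.16) p.393 (bookkeeping)] -/
theorem wBRec_pos (c : PBond (F.P K) k) : 0 < wBRec F K k c := by
  rw [wBRec_eq_one]
  exact one_pos

variable (K) in
/-- The `Fact` the slot type of `frakGOfRecord` wants, as a THEOREM (no instance is declared). [cite: Balaban1985BackgroundPropagators, (3.16) p.393 (bookkeeping)] -/
theorem wBRec_fact : Fact (∀ c : PBond (F.P K) k, 0 < wBRec F K k c) := ⟨wBRec_pos F k⟩

/-- READ-IN of a bond function of the lit carrier `BondL2K ℂ … (WRec N)` as a matrix-valued field on the record's bonds (`phiRec`, `bondToLit`).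
[cite: Balaban1985BackgroundPropagators, (3.11) p.392 (bookkeeping)] -/
def bondFieldIn : BondL2K ℂ (F.P K).d (fun _ => (F.P K).sitesPerDir 0) (c0Rec F K k) (WRec N) →ₗ[ℂ] (PBond (F.P K) 0 → Matrix (Fin N) (Fin N) ℂ) :=
  (LinearMap.pi fun b => (phiRec N).toLinearMap ∘ₗ LinearMap.proj (bondToLit (F.P K) 0 b)) ∘ₗ
    (WL2.linearEquiv ℂ ℂ (fun _ : Bond (F.P K).d (fun _ => (F.P K).sitesPerDir 0) => c0Rec F K k)).toLinearMap

/-- Unfolding of `bondFieldIn`. [cite: Balaban1985BackgroundPropagators, (3.11) p.392 (bookkeeping)] -/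
@[simp] theorem bondFieldIn_apply (A : BondL2K ℂ (F.P K).d (fun _ => (F.P K).sitesPerDir 0) (c0Rec F K k) (WRec N)) (b : PBond (F.P K) 0) :
    bondFieldIn F N k A b = phiRec N (WL2.equiv ℂ _ _ A (bondToLit (F.P K) 0 b)) := rfl

/-- READ-IN of a site (scalar) function of the lit carrier `SiteL2K ℂ … (WRec N)` as a matrix-valued field on the record's sites (`phiRec`, `siteToLit`).
[cite: Balaban1985BackgroundPropagators, (3.11) p.392 (bookkeeping)] -/
def siteFieldIn : SiteL2K ℂ (F.P K).d (fun _ => (F.P K).sitesPerDir 0) (c0Rec F K k) (WRec N) →ₗ[ℂ] (Site (F.P K) 0 → Matrix (Fin N) (Fin N) ℂ) :=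
  (LinearMap.pi fun x => (phiRec N).toLinearMap ∘ₗ LinearMap.proj (siteToLit (F.P K) 0 x)) ∘ₗ
    (WL2.linearEquiv ℂ ℂ (fun _ : TSite (F.P K).d (fun _ => (F.P K).sitesPerDir 0) => c0Rec F K k)).toLinearMap

/-- Unfolding of `siteFieldIn`. [cite: Balaban1985BackgroundPropagators, (3.11) p.392 (bookkeeping)] -/
@[simp] theorem siteFieldIn_apply (f : SiteL2K ℂ (F.P K).d (fun _ => (F.P K).sitesPerDir 0) (c0Rec F K k) (WRec N)) (x : Site (F.P K) 0) :
    siteFieldIn F N k f x = phiRec N (WL2.equiv ℂ _ _ f (siteToLit (F.P K) 0 x)) := rfl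

/-- READ-OUT of a matrix-valued field on level-`k` bonds into the weighted carrier `WL2 ℂ (wBRec F K k) (WRec N)` of (3.16).
[cite: Balaban1985BackgroundPropagators, (3.16) p.393 (bookkeeping)] -/
def bondFieldOut : (PBond (F.P K) k → Matrix (Fin N) (Fin N) ℂ) →ₗ[ℂ] WL2 ℂ (wBRec F K k) (WRec N) :=
  (WL2.linearEquiv ℂ ℂ (wBRec F K k)).symm.toLinearMap ∘ₗ LinearMap.pi fun c => (phiRec N).symm.toLinearMap ∘ₗ LinearMap.proj c

/-- Unfolding of `bondFieldOut`. [cite: Balaban1985BackgroundPropagators, (3.16) p.393 (bookkeeping)] -/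
@[simp] theorem bondFieldOut_apply (Z : PBond (F.P K) k → Matrix (Fin N) (Fin N) ℂ) (c : PBond (F.P K) k) :
    WL2.equiv ℂ _ _ (bondFieldOut F N k Z) c = (phiRec N).symm (Z c) := rfl

/-- ★★★ **`Q = Q(U₀) = Q_k(U₀)` OF RECORD IN THE SLOT TYPE OF `frakGOfRecord`** ((3.13)–(3.16) at the background `U₀`, all-torus): print's `ℂ`-linear
linearised `k`-fold averaging of record `qCplxOp k U₀`, read between the lit carriers. DATA-FREE: determined by `U₀` and the record's averaging.
[cite: Balaban1985BackgroundPropagators, (3.13)–(3.16) p.393; Balaban1985Variational, (44) p.285, (100) p.293] -/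
def QOfRecord (U₀ : GaugeField (F.P K) 0 (SU N)) :
    BondL2K ℂ (F.P K).d (fun _ => (F.P K).sitesPerDir 0) (c0Rec F K k) (WRec N) →ₗ[ℂ] WL2 ℂ (wBRec F K k) (WRec N) :=
  bondFieldOut F N k ∘ₗ qCplxOp k U₀ ∘ₗ bondFieldIn F N k

/-- Unfolding of `QOfRecord`. [cite: Balaban1985BackgroundPropagators, (3.13) p.393 (bookkeeping)] -/
theorem QOfRecord_apply (U₀ : GaugeField (F.P K) 0 (SU N)) (A : BondL2K ℂ (F.P K).d (fun _ => (F.P K).sitesPerDir 0) (c0Rec F K k) (WRec N))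
    (c : PBond (F.P K) k) :
    WL2.equiv ℂ _ _ (QOfRecord F N k U₀ A) c = (phiRec N).symm (qCplxOp k U₀ (bondFieldIn F N k A) c) := rfl

variable [NeZero N]

/-- ★★★ **`Q′ = Q′(U₀) = Q′_k(U₀)` OF RECORD IN THE SLOT TYPE OF `frakGOfRecord`** ((3.18)–(3.19) along the record's averages `Ū^j(U₀)`, centred blocks):
`siteAvgIter (avOfRecord F N K) U₀ k` read from the lit site carrier; codomain the level-`k` matrix-valued site fields (the slot's free `F′` — only
`ker Q′` enters `frakGOfRecord`, through the restriction `RrOfRecord Q′`). [cite: Balaban1985BackgroundPropagators, (3.18)–(3.19) p.393, (3.21) p.394] -/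
def QprimeOfRecord (U₀ : GaugeField (F.P K) 0 (SU N)) :
    SiteL2K ℂ (F.P K).d (fun _ => (F.P K).sitesPerDir 0) (c0Rec F K k) (WRec N) →ₗ[ℂ] (Site (F.P K) k → Matrix (Fin N) (Fin N) ℂ) :=
  siteAvgIter (avOfRecord F N K) U₀ k ∘ₗ siteFieldIn F N k

/-- Unfolding of `QprimeOfRecord`. [cite: Balaban1985BackgroundPropagators, (3.19) p.393 (bookkeeping)] -/
theorem QprimeOfRecord_apply (U₀ : GaugeField (F.P K) 0 (SU N)) (f : SiteL2K ℂ (F.P K).d (fun _ => (F.P K).sitesPerDir 0) (c0Rec F K k) (WRec N)) :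
    QprimeOfRecord F N k U₀ f = siteAvgIter (avOfRecord F N K) U₀ k (siteFieldIn F N k f) := rfl

/-! ## §5. THE PIN: `𝔊(U₀)` and `H₁(U₀)` of record with the record's own `Q(U₀)`, `Q′(U₀)` — data `a`; displayed `hpos`, `hQ` -/

variable (Ω : ℕ → Set (Site (F.P K) 0)) (U₀ : GaugeField (F.P K) 0 (SU N))

variable (K) in
/-- ★★★ **`𝔊(U₀)` OF RECORD AT THE RECORD'S AVERAGING LETTERS** — `frakGOfRecord` with its `Q`, `Q′` slots filled by `QOfRecord`, `QprimeOfRecord`: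
the `𝒢`-slot of `BgSchemeOnLit F N K k Ω U₀` with no operator data left; hypotheses: the number `a`, and the DISPLAYED proofs `hpos`
([Balaban1985BackgroundPropagators] Thm 3.11 at the record) and `hQ` (`Q(U₀)` onto, so that `QG₁Q*` of (103)/(111) is invertible).
[cite: Balaban1985Variational, (110)–(111) p.294, (116)–(117) p.295; Balaban1985BackgroundPropagators, Thm 3.11 p.416, (3.19) p.393] -/
def frakGOfRecordAtBg [Fact (0 < (F.L : ℝ))] [Fact (0 < (F.P K).eta k)] [Fact (0 < c0Rec F K k)] [Fact (∀ c, 0 < wBRec F K k c)] (a : ℝ)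
    (hpos : ∀ x, x ≠ 0 → 0 < RCLike.re ⟪x, laplaceAOfRecord F N k U₀ (QOfRecord F N k U₀) (QprimeOfRecord F N k U₀) a x⟫_ℂ)
    (hQ : Function.Surjective (QOfRecord F N k U₀)) :
    NegSizeLit F N K k Ω 3 →L[ℂ] Space115Lit F N K k Ω U₀ :=
  frakGOfRecord F N K k Ω U₀ (QOfRecord F N k U₀) (QprimeOfRecord F N k U₀) a hpos hQ

variable (K) in
/-- Unfolding (`rfl`): the pinned `𝔊(U₀)` is `frakGOfRecord` at the record's letters. [cite: Balaban1985Variational, (116)–(117) p.295 (bookkeeping)] -/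
theorem frakGOfRecordAtBg_eq [Fact (0 < (F.L : ℝ))] [Fact (0 < (F.P K).eta k)] [Fact (0 < c0Rec F K k)] [Fact (∀ c, 0 < wBRec F K k c)] (a : ℝ)
    (hpos : ∀ x, x ≠ 0 → 0 < RCLike.re ⟪x, laplaceAOfRecord F N k U₀ (QOfRecord F N k U₀) (QprimeOfRecord F N k U₀) a x⟫_ℂ)
    (hQ : Function.Surjective (QOfRecord F N k U₀)) :
    frakGOfRecordAtBg F N K k Ω U₀ a hpos hQ = frakGOfRecord F N K k Ω U₀ (QOfRecord F N k U₀) (QprimeOfRecord F N k U₀) a hpos hQ := rfl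

variable (K) in
/-- **`H₁(U₀)` OF RECORD AT THE RECORD'S AVERAGING LETTERS** (block levels `levB` a datum, as in `H1OfRecord`).
[cite: Balaban1985Variational, (45) p.285, (103) p.293, (174) p.305] -/
def H1OfRecordAtBg [Fact (0 < (F.L : ℝ))] [Fact (0 < (F.P K).eta k)] [Fact (0 < c0Rec F K k)] [Fact (∀ c, 0 < wBRec F K k c)]
    (levB : PBond (F.P K) k → ℕ) (a : ℝ)
    (hpos : ∀ x, x ≠ 0 → 0 < RCLike.re ⟪x, laplaceAOfRecord F N k U₀ (QOfRecord F N k U₀) (QprimeOfRecord F N k U₀) a x⟫_ℂ)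
    (hQ : Function.Surjective (QOfRecord F N k U₀)) :
    NegSize (F.L : ℝ) ((F.P K).eta k) levB 0 (Matrix (Fin N) (Fin N) ℂ) →L[ℂ] Space115Lit F N K k Ω U₀ :=
  H1OfRecord F N K k Ω U₀ levB (QOfRecord F N k U₀) (QprimeOfRecord F N k U₀) a hpos hQ

end Record

end Literature.MathematicalPhysics.QuantumFieldTheory.Balaban1983to89.Node00

end
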